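import Literature.NumberTheory.Transcendental.BakerLogarithmsConclusion

/-!
# `NormalFormPrinciple` (stmt-KontsevichZagierPeriods-3869), line `SketchIdeator1` — the Baker
# endgame `eq_zero_of_alg_add_sum_mul_log_eq_zero`, explicit span-split route

Pure proof file (`--supports` the crux stmt-KontsevichZagierPeriods-3869): the registered sub-goal
`eq_zero_of_alg_add_sum_mul_log_eq_zero` of the algebraic-pole layer of `stub_boxRigidity`
(values `r + Σᵢ Cᵢ log εᵢ` of the normal forms), proved by the EXPLICIT two-step reading of
Baker's theorem (tree, proved: `Literature.NumberTheory.Transcendental.bakerFin_holds`,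
Baker 1975, Theorem 2.1):

* Baker makes `1, log ε₁, …, log ε_s` linearly independent over the field `ℚ̄ ⊆ ℂ` of algebraic
  numbers; split this (`linearIndependent_option`) into (a) `log ε₁, …, log ε_s` are
  `ℚ̄`-independent and (b) `1 ∉ ℚ̄ log ε₁ + ⋯ + ℚ̄ log ε_s`;
* the constant term: if `r ≠ 0`, then `1 = Σᵢ (-Cᵢ/r) log εᵢ` contradicts (b), so `r = 0`;
* the coefficients: with `r = 0` the relation `Σᵢ Cᵢ log εᵢ = 0` has `ℚ̄`-coefficients, so (a)
  gives every `Cᵢ = 0`.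

No elementary (Baker-free) proof can exist: `s = 1` is Hermite–Lindemann and `s = 2`, `r = 0` is
Gelfond–Schneider. Sources: A. Baker, *Transcendental Number Theory* (1975), Theorem 2.1;
M. Kontsevich, D. Zagier, *Periods* (2001), §1.2. No definitions are introduced.
-/

noncomputable section

open Finset

namespace Summit.KontsevichZagierPeriods.HurwitzMicroSectors.NormalFormPrinciple.PiBox

namespace AlgBakerSpanSplit

/-- A real number that is `ℚ`-algebraic lies, read in `ℂ`, in the field `ℚ̄ = algebraicClosure ℚ ℂ`
of complex algebraic numbers. [folklore] -/
theorem ofReal_mem_algebraicClosure {x : ℝ} (hx : IsAlgebraic ℚ x) :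
    (x : ℂ) ∈ algebraicClosure ℚ ℂ :=
  mem_algebraicClosure_iff.mpr hx.algebraMap

/-- `ℚ`-linear independence of a real family survives the passage to `ℂ` (the real part recovers
the family). [folklore] -/
theorem linearIndependent_ofReal {ι : Type*} {v : ι → ℝ} (hv : LinearIndependent ℚ v) :
    LinearIndependent ℚ (fun i => ((v i : ℝ) : ℂ)) := by
  refine LinearIndependent.of_comp (Complex.reLm.restrictScalars ℚ) ?_
  have h : ⇑(Complex.reLm.restrictScalars ℚ) ∘ (fun i => ((v i : ℝ) : ℂ)) = v := by
    funext i
    simp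
  rwa [h]

/-- **Baker, explicit real form (span-split route).** If `l₁, …, l_s` are real numbers with
`e^{lᵢ}` algebraic and `l₁, …, l_s` linearly independent over `ℚ`, then a relation
`b₀ + Σᵢ bᵢ lᵢ = 0` with real ALGEBRAIC `b₀, bᵢ` is trivial. Step 1: `b₀ = 0`, for otherwise
`1 = Σᵢ (-bᵢ/b₀) lᵢ` lies in the `ℚ̄`-span of the `lᵢ`, against Baker; step 2: the `bᵢ` vanish by
the `ℚ̄`-independence of the `lᵢ` (Baker again). [cite: Baker1975, Theorem 2.1] -/
theorem eq_zero_of_alg_add_sum_mul_eq_zero {s : ℕ} (l : Fin s → ℝ)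
    (halg : ∀ i, IsAlgebraic ℚ (Real.exp (l i))) (hli : LinearIndependent ℚ l)
    (b₀ : ℝ) (hb₀ : IsAlgebraic ℚ b₀) (b : Fin s → ℝ) (hb : ∀ i, IsAlgebraic ℚ (b i))
    (h : b₀ + ∑ i, b i * l i = 0) : b₀ = 0 ∧ ∀ i, b i = 0 := by
  classical
  -- Baker for the complex logarithms `lᵢ : ℂ` of the algebraic numbers `e^{lᵢ}`
  have halgC : ∀ i, IsAlgebraic ℚ (Complex.exp ((l i : ℝ) : ℂ)) := fun i => by
    rw [← Complex.ofReal_exp]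
    exact (halg i).algebraMap
  have hB := Literature.NumberTheory.Transcendental.bakerFin_holds s (fun i => ((l i : ℝ) : ℂ))
    halgC (linearIndependent_ofReal hli)
  -- split `1, l₁, …, l_s` into (a) the `lᵢ` are `ℚ̄`-independent, (b) `1 ∉ span_ℚ̄ {lᵢ}`
  rw [linearIndependent_option] at hB
  have hcomp : ((fun o : Option (Fin s) => o.elim (1 : ℂ) fun i => ((l i : ℝ) : ℂ)) ∘
      ((↑) : Fin s → Option (Fin s))) = fun i => ((l i : ℝ) : ℂ) := by
    funext i
    rfl
  rw [hcomp] at hB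
  obtain ⟨hBa, hBb⟩ := hB
  simp only [Option.elim_none] at hBb
  -- the relation, read in `ℂ`
  have hC : ((b₀ : ℝ) : ℂ) + ∑ i, ((b i : ℝ) : ℂ) * ((l i : ℝ) : ℂ) = 0 := by
    have h' := congrArg (fun x : ℝ => (x : ℂ)) h
    simpa only [Complex.ofReal_add, Complex.ofReal_sum, Complex.ofReal_mul,
      Complex.ofReal_zero] using h'
  -- Step 1: the constant coefficient vanishes
  have hb₀0 : b₀ = 0 := by
    by_contra hne
    have hne' : ((b₀ : ℝ) : ℂ) ≠ 0 := Complex.ofReal_ne_zero.mpr hne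
    refine hBb ?_
    -- `1 = Σᵢ (-bᵢ/b₀) • lᵢ` with coefficients in `ℚ̄`
    have hmemK : ∀ i, -((b i : ℝ) : ℂ) / ((b₀ : ℝ) : ℂ) ∈ algebraicClosure ℚ ℂ := fun i =>
      div_mem (neg_mem (ofReal_mem_algebraicClosure (hb i))) (ofReal_mem_algebraicClosure hb₀)
    have h1 : (1 : ℂ) = ∑ i, (⟨-((b i : ℝ) : ℂ) / ((b₀ : ℝ) : ℂ), hmemK i⟩ :
        algebraicClosure ℚ ℂ) • ((l i : ℝ) : ℂ) := by
      simp only [IntermediateField.smul_def, smul_eq_mul]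
      rw [eq_comm]
      calc ∑ i, -((b i : ℝ) : ℂ) / ((b₀ : ℝ) : ℂ) * ((l i : ℝ) : ℂ)
          = -((∑ i, ((b i : ℝ) : ℂ) * ((l i : ℝ) : ℂ)) / ((b₀ : ℝ) : ℂ)) := by
            rw [Finset.sum_div, ← Finset.sum_neg_distrib]
            refine Finset.sum_congr rfl fun i _ => ?_
            ring
        _ = 1 := by
            rw [show ∑ i, ((b i : ℝ) : ℂ) * ((l i : ℝ) : ℂ) = -((b₀ : ℝ) : ℂ) by
              linear_combination hC]
            rw [neg_div, neg_neg, div_self hne']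
    rw [h1]
    exact Submodule.sum_mem _ fun i _ =>
      Submodule.smul_mem _ _ (Submodule.subset_span ⟨i, rfl⟩)
  -- Step 2: the coefficients of the `lᵢ` vanish
  refine ⟨hb₀0, fun i => ?_⟩
  have hsum : ∑ i, (⟨((b i : ℝ) : ℂ), ofReal_mem_algebraicClosure (hb i)⟩ :
      algebraicClosure ℚ ℂ) • ((l i : ℝ) : ℂ) = 0 := by
    simp only [IntermediateField.smul_def, smul_eq_mul]
    have h0 : ((b₀ : ℝ) : ℂ) = 0 := by rw [hb₀0, Complex.ofReal_zero]
    simpa only [h0, zero_add] using hC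
  have hi := Fintype.linearIndependent_iff.mp hBa _ hsum i
  have hi' := congrArg (fun x : algebraicClosure ℚ ℂ => (x : ℂ)) hi
  simp only [ZeroMemClass.coe_zero] at hi'
  exact Complex.ofReal_eq_zero.mp hi'

/-- **The registered sub-goal `eq_zero_of_alg_add_sum_mul_log_eq_zero` (Baker endgame of the
algebraic-pole layer), explicit span-split route.** If `ε₁, …, ε_s > 0` are real algebraic with
`ℚ`-linearly independent logarithms and `r + Σᵢ Cᵢ log εᵢ = 0` with real ALGEBRAIC `r, Cᵢ`, then
`r = 0` and every `Cᵢ = 0`: apply `eq_zero_of_alg_add_sum_mul_eq_zero` to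
`lᵢ = log εᵢ` (`e^{lᵢ} = εᵢ` is algebraic). [cite: Baker1975, Theorem 2.1] -/
theorem eq_zero_of_alg_add_sum_mul_log_eq_zero {s : ℕ} (ε : Fin s → ℝ)
    (hε : ∀ i, 0 < ε i) (hεalg : ∀ i, IsAlgebraic ℚ (ε i))
    (hli : LinearIndependent ℚ (fun i => Real.log (ε i)))
    (r : ℝ) (hr : IsAlgebraic ℚ r) (C : Fin s → ℝ) (hC : ∀ i, IsAlgebraic ℚ (C i))
    (h : r + ∑ i, C i * Real.log (ε i) = 0) : r = 0 ∧ ∀ i, C i = 0 :=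
  eq_zero_of_alg_add_sum_mul_eq_zero (fun i => Real.log (ε i))
    (fun i => by rw [Real.exp_log (hε i)]; exact hεalg i) hli r hr C hC h

end AlgBakerSpanSplit

end Summit.KontsevichZagierPeriods.HurwitzMicroSectors.NormalFormPrinciple.PiBox
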